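import Literature.NumberTheory.EllipticCurves.ZpExtensionEisensteinTwistFreeProofs
import Literature.NumberTheory.EllipticCurves.TorsionFilAtCyclicOrdinaryProofs
import Literature.NumberTheory.EllipticCurves.NeronOggShafarevichLocal
import HarnessLib

/-!
# A basis of `E[p^j]` adapted to the ordinary filtration `Fil_v E[p^j]` (theorems only)

`Proofs` file (theorems only; no definition, no named fact, no instance, no `sorry`).  Topic `NumberTheory/EllipticCurves`
(cell `pub/bsd-print-x9`, memo `HOME/x9-p1-w3/H5B-AT-P-PLAN-w3g5.md`, file V3b: the datum `e : E[p^j] ≃ (ℤ/p^j)²` with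
`x ∈ Fil_v E[p^j] ↔ e(x)₁ = 0` fed to `ZpExtensionEisensteinTwistedFilCoordinatesProofs` (V3a)).
* §1 **`exists_addEquiv_apply_eq_single_of_addOrderOf_eq`** — for `n = p^j` and a vector
  `v : Fin 2 → ℤ/p^j` of additive order `p^j` some coordinate is a unit, and a unimodular change of coordinates
  `T : (ℤ/p^j)² ≃ (ℤ/p^j)²` sends `v` to `δ₀`.
* §2 **`WeierstrassCurve.exists_generator_torsionFilAt_addOrderOf_eq`** — at a place `v ∋ p` of good reduction with an
  ordinary point, `Fil_v E[p^j] = ℤ · P` with `P` of order EXACTLY `p^j` (x10b/x9's `exists_generator_localKernelOfReduction_torsion`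
  — a generator of `E₁(K̄_v)[p^j]` of order `p^j` — pulled back to `E(K̄)` by algebraicity of torsion).
* §3 **`WeierstrassCurve.exists_addEquiv_mem_torsionFilAt_iff`** — `∃ e : E[p^j] ≃+ (ℤ/p^j)², ∀ x, x ∈ Fil_v E[p^j] ↔ e x 1 = 0`.
No summit statement is proved; BSD is not proved by any of this.  Seat `bsd-line-x9-p1-w3` g5.

References: [Howard2004HeegnerKolyvagin] H.0 and §3.1 (arXiv:1202.6340 p. 7 L57; p. 15 L56–62: `Fil_v T` is a rank-one direct
summand); [GreenbergLNM1716] §1 p. 62, §2; [SilvermanAEC2009] Cor. III.6.4, VII.2.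
-/

set_option autoImplicit false

noncomputable section

open Function

namespace Literature.NumberTheory.EllipticCurves

/-! ## §1 Unimodular vectors in `(ℤ/p^j)²` -/

section Unimodular

variable {p : ℕ} [hp : Fact p.Prime] {j : ℕ}

/-- In `ℤ/p^j`: a non-unit is killed by `p^{j-1}` (`j ≥ 1`). [folklore] -/
private theorem pow_pred_mul_eq_zero_of_not_isUnit (hj : 1 ≤ j) {s : ZMod (p ^ j)} (hs : ¬IsUnit s) :
    ((p ^ (j - 1) : ℕ) : ZMod (p ^ j)) * s = 0 := by
  haveI : NeZero (p ^ j) := ⟨pow_ne_zero j hp.out.ne_zero⟩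
  have hval : s = ((s.val : ℕ) : ZMod (p ^ j)) := (ZMod.natCast_zmod_val s).symm
  have hdvd : p ∣ s.val := by
    by_contra hnd
    apply hs
    rw [hval, ZMod.isUnit_iff_coprime]
    exact Nat.Coprime.pow_right j ((Nat.Prime.coprime_iff_not_dvd hp.out).mpr hnd).symm
  obtain ⟨t, ht⟩ := hdvd
  rw [hval, ht, ← Nat.cast_mul, ← mul_assoc, ← pow_succ, Nat.sub_add_cancel hj, Nat.cast_mul, ZMod.natCast_self,
    zero_mul]

/-- A vector of `(ℤ/p^j)²` of additive order `p^j` has a unit coordinate. [folklore] -/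
private theorem isUnit_apply_zero_or_one (hj : 1 ≤ j) (v : Fin 2 → ZMod (p ^ j)) (hv : addOrderOf v = p ^ j) :
    IsUnit (v 0) ∨ IsUnit (v 1) := by
  by_contra h
  push Not at h
  have hkill : (p ^ (j - 1)) • v = 0 := by
    funext i
    rw [Pi.smul_apply, Pi.zero_apply, nsmul_eq_mul]
    fin_cases i
    · exact pow_pred_mul_eq_zero_of_not_isUnit hj h.1
    · exact pow_pred_mul_eq_zero_of_not_isUnit hj h.2
  have hdvd : p ^ j ∣ p ^ (j - 1) := by rw [← hv]; exact addOrderOf_dvd_of_nsmul_eq_zero hkill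
  have := Nat.le_of_dvd (pow_pos hp.out.pos _) hdvd
  have hlt : p ^ (j - 1) < p ^ j := Nat.pow_lt_pow_right hp.out.one_lt (by omega)
  omega

/-- The unimodular change of coordinates: for `v₀` a unit, `(x₀, x₁) ↦ (x₀ v₀⁻¹, x₁ − x₀ v₀⁻¹ v₁)` is an additive automorphism
of `(ℤ/n)²` sending `v` to `δ₀`. [folklore] -/
private theorem exists_addEquiv_apply_eq_single_of_isUnit_zero {n : ℕ} (v : Fin 2 → ZMod n) (hv : IsUnit (v 0)) :
    ∃ T : (Fin 2 → ZMod n) ≃+ (Fin 2 → ZMod n), T v = Pi.single 0 1 := by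
  obtain ⟨u, hu⟩ := hv
  refine ⟨{ toFun := (fun x i ↦ if i = 0 then x 0 * ↑u⁻¹ else x 1 - x 0 * ↑u⁻¹ * v 1),
             invFun := (fun y i ↦ if i = 0 then y 0 * v 0 else y 1 + y 0 * v 1),
             left_inv := (fun x ↦ ?_),
             right_inv := (fun y ↦ ?_),
             map_add' := (fun x y ↦ ?_) }, ?_⟩
  · funext i
    fin_cases i
    · simp only [Fin.zero_eta, if_true, Fin.isValue]
      rw [← hu, mul_assoc, Units.inv_mul, mul_one]
    · simp only [Fin.mk_one, Fin.isValue, one_ne_zero, if_false, if_true]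
      rw [sub_add_cancel]
  · funext i
    fin_cases i
    · simp only [Fin.zero_eta, if_true, Fin.isValue]
      rw [← hu, mul_assoc, Units.mul_inv, mul_one]
    · simp only [Fin.mk_one, Fin.isValue, one_ne_zero, if_false, if_true]
      rw [← hu, mul_assoc (y 0) (u : ZMod n), Units.mul_inv, mul_one, add_sub_cancel_right]
  · funext i
    fin_cases i
    · simp only [Fin.zero_eta, if_true, Fin.isValue, Pi.add_apply]; ring
    · simp only [Fin.mk_one, Fin.isValue, one_ne_zero, if_false, Pi.add_apply]; ring
  · funext i
    fin_cases i
    · simp only [AddEquiv.coe_mk, Equiv.coe_fn_mk, Fin.zero_eta, if_true, Fin.isValue, Pi.single_eq_same]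
      rw [← hu, Units.mul_inv]
    · simp only [AddEquiv.coe_mk, Equiv.coe_fn_mk, Fin.mk_one, Fin.isValue, one_ne_zero, if_false]
      rw [← hu, Units.mul_inv, one_mul, sub_self, Pi.single_apply, if_neg one_ne_zero]

/-- The coordinate swap of `(ℤ/n)²`. [folklore] -/
private theorem exists_addEquiv_swap {n : ℕ} :
    ∃ S : (Fin 2 → ZMod n) ≃+ (Fin 2 → ZMod n), ∀ x, S x 0 = x 1 ∧ S x 1 = x 0 := by
  refine ⟨{ toFun := (fun x i ↦ if i = 0 then x 1 else x 0),
             invFun := (fun x i ↦ if i = 0 then x 1 else x 0),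
             left_inv := (fun x ↦ ?_),
             right_inv := (fun x ↦ ?_),
             map_add' := (fun x y ↦ ?_) }, fun x ↦ ⟨rfl, rfl⟩⟩
  · funext i; fin_cases i <;> simp
  · funext i; fin_cases i <;> simp
  · funext i; fin_cases i <;> simp

/-- **A vector of order `p^j` in `(ℤ/p^j)²` is part of a basis**: some additive automorphism sends it to `δ₀`.
[cite: Howard2004HeegnerKolyvagin, H.0 (arXiv p. 7, L57: T free of rank two)] -/
theorem exists_addEquiv_apply_eq_single_of_addOrderOf_eq (hj : 1 ≤ j) (v : Fin 2 → ZMod (p ^ j)) (hv : addOrderOf v = p ^ j) :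
    ∃ T : (Fin 2 → ZMod (p ^ j)) ≃+ (Fin 2 → ZMod (p ^ j)), T v = Pi.single 0 1 := by
  rcases isUnit_apply_zero_or_one hj v hv with h0 | h1
  · exact exists_addEquiv_apply_eq_single_of_isUnit_zero v h0
  · obtain ⟨S, hS⟩ := exists_addEquiv_swap (n := p ^ j)
    have hSv : IsUnit (S v 0) := by rw [(hS v).1]; exact h1
    obtain ⟨T, hT⟩ := exists_addEquiv_apply_eq_single_of_isUnit_zero (S v) hSv
    exact ⟨S.trans T, by rw [AddEquiv.trans_apply, hT]⟩

end Unimodular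

end Literature.NumberTheory.EllipticCurves

/-! ## §2 A generator of `Fil_v E[p^j]` of order exactly `p^j` -/

namespace WeierstrassCurve

open Literature.NumberTheory.EllipticCurves IsDedekindDomain
open scoped NumberField

variable {K : Type} [Field K] [NumberField K] (W : WeierstrassCurve K) [W.IsElliptic] {p : ℕ} [hp : Fact p.Prime]
  (v : HeightOneSpectrum (𝓞 K))

/-- **`Fil_v E[p^j] = ℤ · P` with `P` of order exactly `p^j`** at a place `v ∋ p` of good reduction with an ordinary point:
the generator of `E₁(K̄_v) ∩ E[p^j]` of order `p^j` is algebraic. [cite: GreenbergLNM1716, §1 p. 62 (ℱ[p^∞] ≅ ℚ_p/ℤ_p)]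
[cite: Howard2004HeegnerKolyvagin, §3.1 (arXiv p. 15, L56–62: Fil_v T has rank one)] [cite: SilvermanAEC2009, Cor. III.6.4] -/
theorem exists_generator_torsionFilAt_addOrderOf_eq (hgood : W.HasGoodReductionAt v) (hpv : (p : 𝓞 K) ∈ v.asIdeal)
    (hord : ∃ P : localPoints W (v.adicCompletion K), (p : ℤ) • P = 0 ∧ P ∉ W.localKernelOfReduction v) (j : ℕ) :
    ∃ P : geomTorsion W ((p : ℤ) ^ j), P ∈ W.torsionFilAt v ((p : ℤ) ^ j) ∧ addOrderOf P = p ^ j ∧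
      ∀ Q ∈ W.torsionFilAt v ((p : ℤ) ^ j), ∃ c : ℕ, Q = c • P := by
  obtain ⟨P₁, hP₁, hord₁, hgen⟩ := W.exists_generator_localKernelOfReduction_torsion v hgood hpv hord j
  have htor : (p ^ j) • P₁ = 0 := by rw [← hord₁]; exact addOrderOf_nsmul_eq_zero P₁
  obtain ⟨P, hP, hPP⟩ := exists_pointsMapOfEmb_eq_of_nsmul_eq_zero W (closureEmb (K := K) (v.adicCompletion K))
    (pow_ne_zero j hp.out.ne_zero) htor
  have hPmem : P ∈ geomTorsion W ((p : ℤ) ^ j) := by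
    rw [mem_geomTorsion_iff, ← Nat.cast_pow, natCast_zsmul]; exact hP
  have hinj : Function.Injective fun Q : geomTorsion W ((p : ℤ) ^ j) ↦
      pointsMapOfEmb W (closureEmb (K := K) (v.adicCompletion K)) (Q : geomPoints W) :=
    fun Q Q' h ↦ Subtype.ext (pointsMapOfEmb_injective W _ h)
  refine ⟨⟨P, hPmem⟩, (W.mem_torsionFilAt_iff v _ _).mpr (by rw [hPP]; exact hP₁), ?_, fun Q hQ ↦ ?_⟩
  · -- the order is preserved by the injective homomorphism `E[p^j] → E(K̄_v)`
    have h := addOrderOf_injective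
      (((pointsMapOfEmb W (closureEmb (K := K) (v.adicCompletion K))).comp (geomTorsion W ((p : ℤ) ^ j)).subtype))
      (fun Q Q' h ↦ hinj h) ⟨P, hPmem⟩
    rw [← h, ← hord₁, AddMonoidHom.comp_apply, AddSubgroup.subtype_apply, hPP]
  · have hQtor : ((p ^ j : ℕ) : ℤ) • pointsMapOfEmb W (closureEmb (K := K) (v.adicCompletion K)) (Q : geomPoints W) = 0 := by
      rw [Nat.cast_pow, ← map_zsmul, (mem_geomTorsion_iff W _ _).mp Q.2, map_zero]
    obtain ⟨c, hc⟩ := hgen _ ((W.mem_torsionFilAt_iff v _ Q).mp hQ) hQtor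
    refine ⟨c, hinj ?_⟩
    change pointsMapOfEmb W _ (Q : geomPoints W) = pointsMapOfEmb W _ ((c • (⟨P, hPmem⟩ : geomTorsion W _) :
      geomTorsion W ((p : ℤ) ^ j)) : geomPoints W)
    rw [hc, ← hPP, AddSubgroupClass.coe_nsmul, map_nsmul]

/-! ## §3 The adapted basis -/

/-- **A basis of `E[p^j]` adapted to `Fil_v E[p^j]`**: an additive isomorphism `e : E[p^j] ≃ (ℤ/p^j)²` with
`x ∈ Fil_v E[p^j] ↔ e(x)₁ = 0` (`Fil_v` is a rank-one direct summand), at a place `v ∋ p` of good reduction with an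
ordinary point, `j ≥ 1`. [cite: Howard2004HeegnerKolyvagin, H.0 and §3.1 (arXiv p. 7 L57, p. 15 L56–62)] [cite: GreenbergLNM1716, §2] -/
theorem exists_addEquiv_mem_torsionFilAt_iff (hgood : W.HasGoodReductionAt v) (hpv : (p : 𝓞 K) ∈ v.asIdeal)
    (hord : ∃ P : localPoints W (v.adicCompletion K), (p : ℤ) • P = 0 ∧ P ∉ W.localKernelOfReduction v) {j : ℕ}
    (hj : 1 ≤ j) :
    ∃ e : geomTorsion W ((p : ℤ) ^ j) ≃+ (Fin 2 → ZMod (p ^ j)), ∀ x, x ∈ W.torsionFilAt v ((p : ℤ) ^ j) ↔ e x 1 = 0 := by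
  haveI : NeZero (p ^ j) := ⟨pow_ne_zero j hp.out.ne_zero⟩
  have hpK : (p : K) ≠ 0 := Nat.cast_ne_zero.mpr hp.out.ne_zero
  obtain ⟨e₀⟩ := W.nonempty_geomTorsion_prime_pow_addEquiv_fin_two hpK j
  obtain ⟨P, hPFil, hPord, hgen⟩ := W.exists_generator_torsionFilAt_addOrderOf_eq v hgood hpv hord j
  have hv : addOrderOf (e₀ P) = p ^ j :=
    (addOrderOf_injective e₀.toAddMonoidHom e₀.injective P).trans hPord
  obtain ⟨T, hT⟩ := exists_addEquiv_apply_eq_single_of_addOrderOf_eq hj (e₀ P) hv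
  refine ⟨e₀.trans T, fun x ↦ ⟨fun hx ↦ ?_, fun hx ↦ ?_⟩⟩
  · obtain ⟨c, rfl⟩ := hgen x hx
    rw [map_nsmul, AddEquiv.trans_apply, hT, Pi.smul_apply, Pi.single_apply, if_neg one_ne_zero, smul_zero]
  · set y := (e₀.trans T) x with hy
    have hxy : (e₀.trans T) x = (e₀.trans T) ((y 0).val • P) := by
      rw [map_nsmul, AddEquiv.trans_apply e₀ T P, hT, ← hy]
      funext i
      fin_cases i
      · change y 0 = ((y 0).val • (Pi.single 0 1 : Fin 2 → ZMod (p ^ j))) 0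
        rw [Pi.smul_apply, Pi.single_eq_same, nsmul_eq_mul, mul_one, ZMod.natCast_zmod_val]
      · change y 1 = ((y 0).val • (Pi.single 0 1 : Fin 2 → ZMod (p ^ j))) 1
        rw [Pi.smul_apply, Pi.single_apply, if_neg one_ne_zero, smul_zero]
        exact hx
    rw [(e₀.trans T).injective hxy]
    exact Submodule.smul_of_tower_mem _ (y 0).val hPFil

end WeierstrassCurve

end
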